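import Summits.Ventures.LatticeQCDFlow.Exactness.IMHCommonRandomNumbersContraction
import HarnessLib

/-!
# The expected disagreement time of two coupled flow-MCMC runs is at most `P(X_0 ≠ X′_0)/A`: the coupled estimator's
# random computing overhead has expectation at most `W = 1/A`, from every initial coupling

HONEST FRAMING: exact (Metropolis-corrected) sampling algorithms for lattice gauge theory;
figures of merit are autocorrelation/cost numbers at stated couplings and volumes; no
continuum-physics claim.

Venture `LatticeQCDFlow` (cell pub-lqcd), topic `Exactness`; FANOUT row 30 (lean-1, GEN-37).  NEW WORK of the cell,
general state space with `MeasurableEq Ω`; sequel to `Exactness/IMHCommonRandomNumbersContraction` (this generation: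
`P(X_n ≠ X′_n) ≤ rⁿ·P(X_0 ≠ X′_0)`, `r = 1 − A`).  The number of shared updates during which the two runs of the CRN pair still
disagree, `T_M = #{n < M : X_n ≠ X′_n}`, is the random overhead of the coupled estimators of GEN-36/37 (every correction
`f(X′_n) − f(Y_n)` vanishes once the runs agree).  Printed counterpart, named only: the «finite expected computing time» of
Jacob–O'Leary–Atchadé's `H_k` (their Assumption 2.2 is a geometric tail of the meeting time; here the tail is GEN-36's theorem and
the constant is the sampler's own `1/A`).

* **`sum_iterate_bind_crnPair_offDiagonal_le`** — `Σ_{n<M} P(X_n ≠ X′_n) ≤ P(X_0 ≠ X′_0)·(1 − r^M)/A ≤ P(X_0 ≠ X′_0)/A`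
  (**`sum_iterate_bind_crnPair_offDiagonal_le'`**), uniformly in `M`;
* **`crn_chain_integral_disagreementCount_le`** — on the pair path law: `E[T_M] = E[Σ_{n<M} 1{X_n ≠ X′_n}] ≤ P(X_0 ≠ X′_0)·W`,
  `W = w(x₀) = 1/A`, for every `M` and every initial coupling — THE EXPECTED TOTAL DISAGREEMENT TIME IS AT MOST `W`;
* **`crn_chain_disagreementCount_markov`** — Markov: `P(T_M ≥ t) ≤ P(X_0 ≠ X′_0)·W/t` for `t > 0`.
Reading (gauge files): two exact gauge samplers on one stream of random numbers disagree, in total and in expectation, during at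
most `1/A` updates (times the probability that they start different) — the coupled estimator's overhead over a plain run.
NOT CLAIMED: the law of the meeting time beyond its expectation bound (GEN-36 Sharp: geometric from (cold, off-mode)); the variance
of `T_M`; anything for two different proposals.  No `sorry`, no new definitions, nothing cited as a fact.
-/

noncomputable section

namespace Summit.Ventures.LatticeQCDFlow.Exactness

open MeasureTheory ProbabilityTheory Function Finset
open scoped ENNReal unitInterval
open Summit.Ventures.LatticeQCDFlow.Scoring

variable {Ω : Type*} [MeasurableSpace Ω] {q : Measure Ω} [IsProbabilityMeasure q] {w : Ω → ℝ}

/-- **`Σ_{n<M} P(X_n ≠ X′_n) ≤ P(X_0 ≠ X′_0)·(1 − r^M)·w(x₀)`** for the CRN pair chain from every initial coupling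
(`w` maximal at `x₀`, `r = 1 − 1/w(x₀)`; `MeasurableEq Ω`). [ours] -/
theorem sum_iterate_bind_crnPair_offDiagonal_le [MeasurableEq Ω] (hw : Measurable w) (hw0 : ∀ y, 0 < w y) {x₀ : Ω}
    (hmax : ∀ y, w y ≤ w x₀) [IsProbabilityMeasure (q.withDensity fun y => ENNReal.ofReal (w y))]
    (Khat : Kernel (Ω × Ω) (Ω × Ω)) [IsMarkovKernel Khat]
    (hK : ∀ z : Ω × Ω, Khat z = (q.prod (volume : Measure unitInterval)).map (fun p : Ω × unitInterval =>
      ((if (p.2 : ℝ) * w z.1 ≤ w p.1 then p.1 else z.1), (if (p.2 : ℝ) * w z.2 ≤ w p.1 then p.1 else z.2))))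
    (M : ℕ) (μ₀ : Measure (Ω × Ω)) [IsProbabilityMeasure μ₀] :
    ∑ n ∈ Finset.range M, ((fun m : Measure (Ω × Ω) => m.bind Khat)^[n] μ₀).real (Set.diagonal Ω)ᶜ ≤
      μ₀.real (Set.diagonal Ω)ᶜ * (1 - (1 - (w x₀)⁻¹) ^ M) * w x₀ := by
  have hW : 1 ≤ w x₀ := one_le_of_mode (q := q) hmax
  have hWpos : 0 < w x₀ := hw0 x₀
  have hr0 : 0 ≤ 1 - (w x₀)⁻¹ := sub_nonneg.2 (inv_le_one_of_one_le₀ hW)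
  have hgeom : ∑ n ∈ range M, (1 - (w x₀)⁻¹) ^ n = (1 - (1 - (w x₀)⁻¹) ^ M) * w x₀ := by
    rw [geom_sum_eq (by
      intro h
      have : (w x₀)⁻¹ = 0 := by linarith
      exact (inv_ne_zero hWpos.ne') this)]
    field_simp
    ring
  calc ∑ n ∈ range M, ((fun m : Measure (Ω × Ω) => m.bind Khat)^[n] μ₀).real (Set.diagonal Ω)ᶜ
      ≤ ∑ n ∈ range M, (1 - (w x₀)⁻¹) ^ n * μ₀.real (Set.diagonal Ω)ᶜ :=
        sum_le_sum fun n _ => iterate_bind_crnPair_offDiagonal_le hw hw0 hmax Khat hK n μ₀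
    _ = μ₀.real (Set.diagonal Ω)ᶜ * ∑ n ∈ range M, (1 - (w x₀)⁻¹) ^ n := by rw [mul_sum]; exact sum_congr rfl fun n _ => mul_comm _ _
    _ = μ₀.real (Set.diagonal Ω)ᶜ * (1 - (1 - (w x₀)⁻¹) ^ M) * w x₀ := by rw [hgeom, mul_assoc]

/-- **`Σ_{n<M} P(X_n ≠ X′_n) ≤ P(X_0 ≠ X′_0)·w(x₀)`**, uniformly in `M`. [ours] -/
theorem sum_iterate_bind_crnPair_offDiagonal_le' [MeasurableEq Ω] (hw : Measurable w) (hw0 : ∀ y, 0 < w y) {x₀ : Ω}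
    (hmax : ∀ y, w y ≤ w x₀) [IsProbabilityMeasure (q.withDensity fun y => ENNReal.ofReal (w y))]
    (Khat : Kernel (Ω × Ω) (Ω × Ω)) [IsMarkovKernel Khat]
    (hK : ∀ z : Ω × Ω, Khat z = (q.prod (volume : Measure unitInterval)).map (fun p : Ω × unitInterval =>
      ((if (p.2 : ℝ) * w z.1 ≤ w p.1 then p.1 else z.1), (if (p.2 : ℝ) * w z.2 ≤ w p.1 then p.1 else z.2))))
    (M : ℕ) (μ₀ : Measure (Ω × Ω)) [IsProbabilityMeasure μ₀] :
    ∑ n ∈ Finset.range M, ((fun m : Measure (Ω × Ω) => m.bind Khat)^[n] μ₀).real (Set.diagonal Ω)ᶜ ≤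
      μ₀.real (Set.diagonal Ω)ᶜ * w x₀ := by
  have hW : 1 ≤ w x₀ := one_le_of_mode (q := q) hmax
  have hr0 : 0 ≤ 1 - (w x₀)⁻¹ := sub_nonneg.2 (inv_le_one_of_one_le₀ hW)
  refine (sum_iterate_bind_crnPair_offDiagonal_le hw hw0 hmax Khat hK M μ₀).trans ?_
  have h1 : 1 - (1 - (w x₀)⁻¹) ^ M ≤ 1 := sub_le_self _ (pow_nonneg hr0 M)
  have := mul_le_mul_of_nonneg_left h1 measureReal_nonneg (b := 1 - (1 - (w x₀)⁻¹) ^ M) (a := μ₀.real (Set.diagonal Ω)ᶜ)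
  nlinarith [hw0 x₀, measureReal_nonneg (μ := μ₀) (s := (Set.diagonal Ω)ᶜ)]

/-- **THE EXPECTED TOTAL DISAGREEMENT TIME IS AT MOST `P(X_0 ≠ X′_0)·W`**: on the pair path law from every initial coupling,
`E[Σ_{n<M} 1{X_n ≠ X′_n}] ≤ P(X_0 ≠ X′_0)·w(x₀)` for every `M` (`w` measurable as a `Fact`). [ours] -/
theorem crn_chain_integral_disagreementCount_le [MeasurableEq Ω] [Fact (Measurable w)] (hw0 : ∀ y, 0 < w y) {x₀ : Ω}
    (hmax : ∀ y, w y ≤ w x₀) [IsProbabilityMeasure (q.withDensity fun y => ENNReal.ofReal (w y))]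
    (Khat : Kernel (Ω × Ω) (Ω × Ω)) [IsMarkovKernel Khat]
    (hK : ∀ z : Ω × Ω, Khat z = (q.prod (volume : Measure unitInterval)).map (fun p : Ω × unitInterval =>
      ((if (p.2 : ℝ) * w z.1 ≤ w p.1 then p.1 else z.1), (if (p.2 : ℝ) * w z.2 ≤ w p.1 then p.1 else z.2))))
    (μ₀ : Measure (Ω × Ω)) [IsProbabilityMeasure μ₀] (M : ℕ) :
    ∫ z, (∑ n ∈ Finset.range M, ((Set.diagonal Ω)ᶜ).indicator (1 : Ω × Ω → ℝ) (z n))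
        ∂(Kernel.trajMeasure (X := fun _ : ℕ => Ω × Ω) μ₀
          (fun n : ℕ => Khat.comap (fun h : (i : ↥(Finset.Iic n)) → Ω × Ω => h ⟨n, Finset.mem_Iic.2 le_rfl⟩)
            (measurable_pi_apply _))) ≤ μ₀.real (Set.diagonal Ω)ᶜ * w x₀ := by
  set P := Kernel.trajMeasure (X := fun _ : ℕ => Ω × Ω) μ₀
      (fun n : ℕ => Khat.comap (fun h : (i : ↥(Finset.Iic n)) → Ω × Ω => h ⟨n, Finset.mem_Iic.2 le_rfl⟩)
        (measurable_pi_apply _)) with hP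
  have hD : MeasurableSet (Set.diagonal Ω) := measurableSet_diagonal
  have hIm : Measurable ((Set.diagonal Ω)ᶜ.indicator (1 : Ω × Ω → ℝ)) := measurable_one.indicator hD.compl
  have hIb : ∀ p : Ω × Ω, |(Set.diagonal Ω)ᶜ.indicator (1 : Ω × Ω → ℝ) p| ≤ 1 := by
    intro p
    by_cases hp : p ∈ (Set.diagonal Ω)ᶜ
    · rw [Set.indicator_of_mem hp, Pi.one_apply, abs_one]
    · rw [Set.indicator_of_notMem hp, abs_zero]; exact zero_le_one
  have hIi : ∀ n, Integrable (fun z : ℕ → Ω × Ω => (Set.diagonal Ω)ᶜ.indicator (1 : Ω × Ω → ℝ) (z n)) P := fun n =>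
    integrable_of_bounded P (hIm.comp (measurable_pi_apply n)) (fun z => hIb _)
  rw [integral_finsetSum _ fun n _ => hIi n]
  have hterm : ∀ n, ∫ z, (Set.diagonal Ω)ᶜ.indicator (1 : Ω × Ω → ℝ) (z n) ∂P =
      ((fun m : Measure (Ω × Ω) => m.bind Khat)^[n] μ₀).real (Set.diagonal Ω)ᶜ := by
    intro n
    haveI := isProbabilityMeasure_iterate_bind (κ := Khat) μ₀ n
    rw [hP, chain_expect_eq_integral_iterate_bind Khat μ₀ hIm hIb n, integral_indicator_one hD.compl]
  simp_rw [hterm]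
  exact sum_iterate_bind_crnPair_offDiagonal_le' Fact.out hw0 hmax Khat hK M μ₀

/-- **MARKOV FOR THE DISAGREEMENT TIME**: `P(T_M ≥ t) ≤ P(X_0 ≠ X′_0)·w(x₀)/t` for `t > 0`, `T_M = Σ_{n<M} 1{X_n ≠ X′_n}`. [ours] -/
theorem crn_chain_disagreementCount_markov [MeasurableEq Ω] [Fact (Measurable w)] (hw0 : ∀ y, 0 < w y) {x₀ : Ω}
    (hmax : ∀ y, w y ≤ w x₀) [IsProbabilityMeasure (q.withDensity fun y => ENNReal.ofReal (w y))]
    (Khat : Kernel (Ω × Ω) (Ω × Ω)) [IsMarkovKernel Khat]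
    (hK : ∀ z : Ω × Ω, Khat z = (q.prod (volume : Measure unitInterval)).map (fun p : Ω × unitInterval =>
      ((if (p.2 : ℝ) * w z.1 ≤ w p.1 then p.1 else z.1), (if (p.2 : ℝ) * w z.2 ≤ w p.1 then p.1 else z.2))))
    (μ₀ : Measure (Ω × Ω)) [IsProbabilityMeasure μ₀] (M : ℕ) {t : ℝ} (ht : 0 < t) :
    (Kernel.trajMeasure (X := fun _ : ℕ => Ω × Ω) μ₀
          (fun n : ℕ => Khat.comap (fun h : (i : ↥(Finset.Iic n)) → Ω × Ω => h ⟨n, Finset.mem_Iic.2 le_rfl⟩)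
            (measurable_pi_apply _))).real
        {z | t ≤ ∑ n ∈ Finset.range M, ((Set.diagonal Ω)ᶜ).indicator (1 : Ω × Ω → ℝ) (z n)} ≤
      μ₀.real (Set.diagonal Ω)ᶜ * w x₀ / t := by
  set P := Kernel.trajMeasure (X := fun _ : ℕ => Ω × Ω) μ₀
      (fun n : ℕ => Khat.comap (fun h : (i : ↥(Finset.Iic n)) → Ω × Ω => h ⟨n, Finset.mem_Iic.2 le_rfl⟩)
        (measurable_pi_apply _)) with hP
  have hD : MeasurableSet (Set.diagonal Ω) := measurableSet_diagonal
  have hIm : Measurable ((Set.diagonal Ω)ᶜ.indicator (1 : Ω × Ω → ℝ)) := measurable_one.indicator hD.compl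
  have hTm : Measurable (fun z : ℕ → Ω × Ω => ∑ n ∈ range M, (Set.diagonal Ω)ᶜ.indicator (1 : Ω × Ω → ℝ) (z n)) :=
    Finset.measurable_sum _ fun n _ => hIm.comp (measurable_pi_apply n)
  have hTnn : ∀ z : ℕ → Ω × Ω, 0 ≤ ∑ n ∈ range M, (Set.diagonal Ω)ᶜ.indicator (1 : Ω × Ω → ℝ) (z n) := fun z =>
    sum_nonneg fun n _ => Set.indicator_nonneg (fun _ _ => zero_le_one) _
  have hTi : Integrable (fun z : ℕ → Ω × Ω => ∑ n ∈ range M, (Set.diagonal Ω)ᶜ.indicator (1 : Ω × Ω → ℝ) (z n)) P :=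
    integrable_of_bounded P hTm (C := M) (fun z => by
      rw [abs_of_nonneg (hTnn z)]
      calc ∑ n ∈ range M, (Set.diagonal Ω)ᶜ.indicator (1 : Ω × Ω → ℝ) (z n) ≤ ∑ n ∈ range M, (1 : ℝ) :=
            sum_le_sum fun n _ => Set.indicator_le_self' (fun _ _ => zero_le_one) _
        _ = M := by rw [sum_const, card_range, nsmul_eq_mul, mul_one])
  have hmarkov := mul_meas_ge_le_integral_of_nonneg (μ := P) (ae_of_all _ hTnn) hTi t
  have hE := crn_chain_integral_disagreementCount_le hw0 hmax Khat hK μ₀ M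
  rw [← hP] at hE
  rw [measureReal_def, le_div_iff₀ ht, mul_comm]
  calc t * (P {z | t ≤ ∑ n ∈ range M, (Set.diagonal Ω)ᶜ.indicator (1 : Ω × Ω → ℝ) (z n)}).toReal
      ≤ ∫ z, ∑ n ∈ range M, (Set.diagonal Ω)ᶜ.indicator (1 : Ω × Ω → ℝ) (z n) ∂P := hmarkov
    _ ≤ μ₀.real (Set.diagonal Ω)ᶜ * w x₀ := hE

end Summit.Ventures.LatticeQCDFlow.Exactness

end
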